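import Literature.MathematicalPhysics.QuantumFieldTheory.Balaban1983to89.B9Cor35GAtCubeLetters

/-!
# `Balaban1983to89.B9Cor35GAtCubeLettersFirstOrder` — [B9] COROLLARY 3.5 p. 407 ∕ THEOREM 3.4's `G`-CLAUSE FOR THE BOND-SECTOR CUBE LETTER `G_□ = Δ_{a,□}⁻¹`,
# THE ASSEMBLY WITH THE PROJECTION PIECE IN PRINT'S SHAPE: `D₁R_□(1)D*₁ − D_VR_□(V)D*_V = V₂(A) + P₁(A)` with `V₂(A) = P⁰ + Σ_ν P¹_ν·∇_ν` a LOCAL FIRST-ORDER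
# operator ((3.75), bounds (3.73)) and `P₁(A)` the non-local zeroth-order word of (3.76)–(3.77) — G-F5's `cor35_G_cube_of_pieces` re-assembled with the
# hypothesis `hPr` replaced by `hProj : projPieceK = P⁰ + Σ_ν P¹_ν·DK ν + P₁` and (3.73)∕(3.77)-shaped majorants of the three parts (sub-row G-B9-LETTERS,
# module M5.1b-G, FILE G-F5′)

T. Bałaban, *Propagators for lattice gauge theories in a background field*, Commun. Math. Phys. **99** (1985) 389–434
[`Balaban1985BackgroundPropagators`, "B9"]; [4] = T. Bałaban, *Propagators and renormalization transformations for lattice gauge theories. II*,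
Commun. Math. Phys. **96** (1984) 223–250 [`Balaban1984PropagatorsII`].

statement-level skeleton of published theorems with citation tags; proofs where landed; nothing here is a claim about the
Yang–Mills mass gap

THE PRINTED LOCUS (verbatim, held `paper:balaban1985-cmp99-background-propagators`, journal page = PDF page + 388; page owner r06).  p. 405 (3.75)–(3.76):
*«(D_{U′U}D\*_{U′U}A′)_μ(x) = … = (DD\*A′)_μ(x) − (V₂(A)A′)_μ(x), (3.75) where the operators F_{2,k}(A), V₂(A) satisfy the bounds (3.72), (3.73). These expansions imply
the following one: D_{U′U}R(U′U)D\*_{U′U} = … = DRD\* − V₂(A) − P₁(A), (3.76)»*; p. 407 (3.82)–(3.85): *«Δ_a(U′U) = … = Δ_a(U) − V₃(A) − P₁(A) − P₂(A). (3.82)  The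
operator V₃(A) is a local differential operator of the first order satisfying the bound (3.73). The operator P₁(A) was defined in (3.76). It is a non-local bounded operator and
satisfies the bound (3.77) … Using the bounds (3.73), (3.77), (3.83) and assuming that Theorem 3.3 holds for G(U), we get |(V(A)G(U)J)(b)| ≦ O(1)α₁e^{−(1/2)δ₀d(y,y′)}|J|
… (3.85)»*; Cor. 3.5 p. 407; Thm 3.4 p. 400; p. 409 l. 1–5.

WHY THIS FILE (cell `lit-balaban`, sub-row G-B9-LETTERS; module M5.1b-G).  G-F5 (`B9Cor35GAtCubeLetters.cor35_G_cube_of_pieces`, p645320) assembled Cor. 3.5 for `G_□`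
from the three letter pieces of `V = Δ_{a,□}(1) − Δ_{a,□}(U′)` with the projection piece displayed as ONE zeroth-order majorant `projPieceK ≺ κ₁α₁(len²)⁻¹e^{−δd}`.
But `projPieceK b i □ parS V = conj b((D₁R_□(1)D*₁ − D_VR_□(V)D*_V)^ℝ)`, `R_□ = 1 − P_□`, is print's `V₂(A) + P₁(A)`: `P₁(A)` IS zeroth order ((3.77)), `V₂(A) =
D₁D*₁ − D_VD*_V` is a LOCAL FIRST-ORDER operator with the (3.73)-shape `α₁((Lⁿη)⁻¹|∇X| + (Lⁿη)⁻²|X|)` (print puts it into `V₃(A)`, (3.82)); a zeroth-order majorant of it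
would cost the factor `Lⁿ`.  G-F5b part I (`B9Eq375GradDivSplitY`, p652820) proved `D₁D*₁ − D_VD*_V = P⁰ + Σ_ν P¹_ν∘∇_ν` at def-Y's letters.  THIS FILE re-runs G-F5's
assembly (`ineq385_op_dirs` + `gStep_cube`, BY NAME, G-F5 untouched) with the projection piece taken in print's shape `P⁰ + Σ_ν P¹_ν·DK ν + P₁`: the first-order words
of `V₂` are merged with those of the Laplacian piece (`V⁰ + P⁰`, `V¹_ν + P¹_ν`), `P₁` takes the `κ₁`-slot.

WHAT THIS FILE PROVES (THEOREMS only; 0 `def`, 0 `def … : Prop`, 0 sorry).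
★★ `h385_of_pieces₂` — the `h385` input of `gStep_cube` from: `hG`, `hDG ν` (U = 1 entries), `hLap : lapPieceK = V⁰ + Σ_νV¹_ν·DK ν` with (3.73)-majorants (`cV`),
`hProj : projPieceK = P⁰ + Σ_νP¹_ν·DK ν + P₁` with (3.73)-majorants of `P⁰`, `P¹_ν` (`cP`) and a (3.77)-majorant of `P₁` (`κ₁`), `hAv` (`κ₂`), (2.61), transfers:
`V·G ≺ κ·α₁·e^{−ρd}` with `κ = kappa385d B₀ (cV + cP) κ₁ κ₂ Λ c₁ (d+1)`; ★★★ `cor35_G_cube_of_pieces₂` — `IsUnit Δ_{a,□}(U′)` ∧ both (3.86) resolvent identities ∧ the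
transfer of every left (3.42)-entry, from the same + (2.61) at `(ρ, α′)` + `κα₁c₁ < 1`.

HONEST SCOPE.  Bookkeeping over landed modules (G-F4's `gStep_cube`, G-F5's `ineq385_op_dirs`∕`VK_eq_pieces`, r06's majorant calculus) — all BY NAME; nothing of [B9]'s
analysis is asserted.  DISPLAYED (hypotheses, not proved here): the decompositions `hLap` (G-F5a II ✓), `hProj` (G-F5b: part I ✓ for `V₂`, the `P₁` word to come) and their
majorants (G-F5a III ✓, G-F5b II, the (3.77) file), `hAv` (G-F5c ✓), the `U = 1` entries (G-F4 ✓), (2.61) twice and the scale transfers (p33), the smallness `κα₁c₁ < 1`,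
`parS 1 = 1`, `0 < b₀`.  Right (3.42)-entries, Hölder ∕ `L²` members NOT treated.  Count-neutral; NOT a node discharge; no summit ∕ sub-problem statement is proved; nothing
continuum ∕ OS ∕ mass-gap ∕ Clay; YM mass gap NOT proved by any of this (Track A conditional rung).  No `sorry`, no `axiom`, no `… : Prop` fact, no `instance`, no `notation`.
NEW file; nothing landed is modified.  Cell `lit-balaban`, seat `lit-balaban-p38` gen 43, 2026-08-28; `--supports stmt-QuantumFields-19200` as helper.
Net new unproved facts: 0.

RELATED IN THE TREE, NOT DUPLICATED: G-F5 `B9Cor35GAtCubeLetters` (the narrower assembly; `ineq385_op_dirs`, `VK_eq_pieces`, `kappa385d` USED BY NAME), G-F4 `gStep_cube`, r06's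
`B9Ineq385VG.ineq385_op` ∕ `B9Eq386Neumann` (letter-free (3.84)–(3.86)).
-/

noncomputable section

namespace Literature.MathematicalPhysics.QuantumFieldTheory.Balaban1983to89.B9Cor35GAtCubeLettersFirstOrder

open Node00
open Literature.MathematicalPhysics.QuantumFieldTheory.Balaban1983to89
open Literature.MathematicalPhysics.QuantumFieldTheory.Balaban1983to89.B6RandomWalk (HasMajorant hasMajorant_mono hasMajorant_add Ineq261)
open Literature.MathematicalPhysics.QuantumFieldTheory.Balaban1983to89.B9Thm34Ext (toB6)
open Literature.MathematicalPhysics.QuantumFieldTheory.Balaban1983to89.B9Ineq347 (ScaleTransfer)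
open Literature.MathematicalPhysics.QuantumFieldTheory.Balaban1983to89.B6KLevelCensusIndexV1 (KIdx kGeo)
open Literature.MathematicalPhysics.QuantumFieldTheory.Balaban1983to89.B6Cover236MultiLevelBlocks (cubes)
open Literature.MathematicalPhysics.QuantumFieldTheory.Balaban1983to89.B9CubeLettersBondOpsL0 (BlkCubeY deltaACubeY)
open Literature.MathematicalPhysics.QuantumFieldTheory.Balaban1983to89.B9CubeGeometryInputs (geoCK geoCK_len geoCK_len_pos geoCK_dist geoCK_dist_axioms)
open Literature.MathematicalPhysics.QuantumFieldTheory.Balaban1983to89.B9Cor35GCubeInputsAtOne (blkBK GK DK GVK VK gStep_cube)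
open Literature.MathematicalPhysics.QuantumFieldTheory.Balaban1983to89.B9Cor35GCubeAvgPiece (avgPieceK)
open Literature.MathematicalPhysics.QuantumFieldTheory.Balaban1983to89.B9Cor35GAtCubeLetters (kappa385d kappa385d_nonneg ineq385_op_dirs lapPieceK projPieceK VK_eq_pieces)

variable {d ℓ : ℕ} {hd : 1 ≤ d + 1} {hL : Odd (ℓ + 1) ∧ 1 < ℓ + 1} {b₀ b₁ : ℝ}
variable {𝔸 : Type} [NormedRing 𝔸] [NormedAlgebra ℂ 𝔸] [CompleteSpace 𝔸]
variable {ιb : Type} [Fintype ιb] (b : Module.Basis ιb ℝ 𝔸)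
variable (i : KIdx d ℓ hd hL b₀ b₁) (q : ↥(cubes (toKT i).D.toDomains)) (parS : SiteParY 𝔸 i)

/-- ★★ **THE (3.85)-MAJORANT `h385` OF `gStep_cube` FROM THE PIECES, PROJECTION PIECE IN PRINT'S SHAPE `V₂(A) + P₁(A)`**: given the `U = 1` entries `G ≺ B₀(Lⁿη)²e^{−δd}`,
`∇_νG ≺ B₀(Lⁿη)e^{−δd}`, the Laplacian piece `V⁰ + Σ_νV¹_ν∇_ν` with (3.73)-shaped majorants (constant `c_V`), the projection piece `P⁰ + Σ_νP¹_ν∇_ν + P₁` with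
(3.73)-shaped majorants of `P⁰`, `P¹_ν` (constant `c_P`) and a (3.77)-shaped majorant of `P₁` (constant `κ₁`), the averaging piece's (3.83)-majorant (`κ₂`), [4] (2.61) at
`(δ₀, β)` and the p. 398 scale transfers at `(δ₀, α)` with `ρ + (α+β)δ₀ ≤ δ`: `V·G ≺ κ·α₁·e^{−ρd}`, `κ = B₀Λc₁((d+2)(c_V + c_P) + κ₁ + κ₂)`.
[cite: Balaban1985BackgroundPropagators, (3.85) p.407, (3.73) p.405, (3.75)–(3.77) pp.405–406, (3.82)–(3.83) p.407, Thm 3.3 p.399, p.409 l.1–5; Balaban1984PropagatorsII, Lemma 2.1 p.234, (2.52)–(2.55) p.232] -/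
theorem h385_of_pieces₂ (Rr : ℝ) (H : Prop) (dB : ℕ) (δ₀ δ α β ρ Λ B₀ cV cP κ₁ κ₂ α₁ : ℝ)
    (hB₀ : 0 ≤ B₀) (hcV : 0 ≤ cV) (hcP : 0 ≤ cP) (hκ₁ : 0 ≤ κ₁) (hκ₂ : 0 ≤ κ₂) (hα₁ : 0 ≤ α₁) (hΛ : 0 ≤ Λ) (hρ : 0 ≤ ρ)
    (hα : 0 ≤ α) (hβ : 0 ≤ β) (hδ₀ : 0 ≤ δ₀) (hr : ρ + (α + β) * δ₀ ≤ δ)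
    (h261 : Ineq261 dB (toB6 (geoCK i q) Rr H) δ₀ β)
    (hT1 : ScaleTransfer (geoCK i q) δ₀ α Λ (fun a => (geoCK i q).len a)) (hT2 : ScaleTransfer (geoCK i q) δ₀ α Λ (fun a => (geoCK i q).len a ^ 2))
    (V : CfgY 𝔸 i)
    (hG : HasMajorant (g := toB6 (geoCK i q) Rr H) (blkBK i q) (GK b i q parS (parBY i))
      (fun a a' => B₀ * (geoCK i q).len a ^ 2 * Real.exp (-(δ * (geoCK i q).dist a a'))))
    (hDG : ∀ ν, HasMajorant (g := toB6 (geoCK i q) Rr H) (blkBK i q) (DK b i ν * GK b i q parS (parBY i))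
      (fun a a' => B₀ * (geoCK i q).len a * Real.exp (-(δ * (geoCK i q).dist a a'))))
    {V0 P0 PP : Module.End ℝ (FBondY i × ιb → ℝ)} {V1 P1 : Fin (d + 1) → Module.End ℝ (FBondY i × ιb → ℝ)}
    (hLap : lapPieceK b i V = V0 + ∑ ν, V1 ν * DK b i ν)
    (hV0 : HasMajorant (g := toB6 (geoCK i q) Rr H) (blkBK i q) V0 (fun a a' => cV * α₁ * ((geoCK i q).len a ^ 2)⁻¹ * Real.exp (-(δ * (geoCK i q).dist a a'))))
    (hV1 : ∀ ν, HasMajorant (g := toB6 (geoCK i q) Rr H) (blkBK i q) (V1 ν) (fun a a' => cV * α₁ * ((geoCK i q).len a)⁻¹ * Real.exp (-(δ * (geoCK i q).dist a a'))))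
    (hProj : projPieceK b i q parS V = P0 + ∑ ν, P1 ν * DK b i ν + PP)
    (hP0 : HasMajorant (g := toB6 (geoCK i q) Rr H) (blkBK i q) P0 (fun a a' => cP * α₁ * ((geoCK i q).len a ^ 2)⁻¹ * Real.exp (-(δ * (geoCK i q).dist a a'))))
    (hP1 : ∀ ν, HasMajorant (g := toB6 (geoCK i q) Rr H) (blkBK i q) (P1 ν) (fun a a' => cP * α₁ * ((geoCK i q).len a)⁻¹ * Real.exp (-(δ * (geoCK i q).dist a a'))))
    (hPP : HasMajorant (g := toB6 (geoCK i q) Rr H) (blkBK i q) PP (fun a a' => κ₁ * α₁ * ((geoCK i q).len a ^ 2)⁻¹ * Real.exp (-(δ * (geoCK i q).dist a a'))))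
    (hAv : HasMajorant (g := toB6 (geoCK i q) Rr H) (blkBK i q) (avgPieceK b i q V)
      (fun a a' => κ₂ * α₁ * ((geoCK i q).len a ^ 2)⁻¹ * Real.exp (-(δ * (geoCK i q).dist a a')))) :
    HasMajorant (g := toB6 (geoCK i q) Rr H) (blkBK i q) (VK b i q parS (parBY i) V * GK b i q parS (parBY i))
      (fun a a' => kappa385d B₀ (cV + cP) κ₁ κ₂ Λ (B6.c1 dB δ₀ β) (d + 1) * α₁ * Real.exp (-(ρ * (geoCK i q).dist a a'))) := by
  obtain ⟨hdnn, htri, -, -⟩ := geoCK_dist_axioms i q Rr H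
  -- the merged first-order words `V⁰ + P⁰`, `V¹_ν + P¹_ν`
  have hW0 : HasMajorant (g := toB6 (geoCK i q) Rr H) (blkBK i q) (V0 + P0)
      (fun a a' => (cV + cP) * α₁ * ((geoCK i q).len a ^ 2)⁻¹ * Real.exp (-(δ * (geoCK i q).dist a a'))) :=
    hasMajorant_mono (g := toB6 (geoCK i q) Rr H) (blkBK i q) (hasMajorant_add (g := toB6 (geoCK i q) Rr H) (blkBK i q) hV0 hP0) fun a a' => by
      simp only; ring_nf; rfl
  have hW1 : ∀ ν, HasMajorant (g := toB6 (geoCK i q) Rr H) (blkBK i q) (V1 ν + P1 ν)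
      (fun a a' => (cV + cP) * α₁ * ((geoCK i q).len a)⁻¹ * Real.exp (-(δ * (geoCK i q).dist a a'))) := fun ν =>
    hasMajorant_mono (g := toB6 (geoCK i q) Rr H) (blkBK i q) (hasMajorant_add (g := toB6 (geoCK i q) Rr H) (blkBK i q) (hV1 ν) (hP1 ν)) fun a a' => by
      simp only; ring_nf; rfl
  have h := ineq385_op_dirs (R := Rr) (H := H) (blkBK i q) dB δ₀ δ α β ρ Λ B₀ (cV + cP) κ₁ κ₂ α₁ hB₀ (add_nonneg hcV hcP) hκ₁ hκ₂ hα₁ hΛ hρ hα hβ hδ₀ hr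
    hdnn htri (geoCK_len_pos i q) h261 hT1 hT2 hW0 hW1 hPP hAv hG hDG
  have e : VK b i q parS (parBY i) V = (V0 + P0) + ∑ ν, (V1 ν + P1 ν) * DK b i ν + PP + avgPieceK b i q V := by
    rw [VK_eq_pieces, hLap, hProj]
    have e2 : ∑ ν, (V1 ν + P1 ν) * DK b i ν = ∑ ν, V1 ν * DK b i ν + ∑ ν, P1 ν * DK b i ν := by
      rw [← Finset.sum_add_distrib]
      exact Finset.sum_congr rfl fun ν _ => add_mul _ _ _
    rw [e2]
    abel
  rw [e]
  simpa [Fintype.card_fin] using h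

/-- ★★★ **COROLLARY 3.5 ∕ THEOREM 3.4's `G`-CLAUSE FOR THE BOND-SECTOR CUBE LETTER `G_□ = Δ_{a,□}⁻¹`, THE PROJECTION PIECE IN PRINT'S SHAPE `V₂(A) + P₁(A)`**
(p. 407 «The theorems hold also for the operators (3.24), (3.25) … with U = 1»; p. 409 l. 1–5): at any background `U′` (meant `Ṽ_□ = e^{iηχ̃_□A}`, Cor. 3.6's cube road) —
from the `U = 1` entries of `G_□(1)`, the Laplacian piece `V⁰ + Σ_νV¹_ν∇_ν`, the projection piece `P⁰ + Σ_νP¹_ν∇_ν + P₁`, the averaging piece, [4] Lemma 2.1 at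
`(δ₀, β)` and at `(ρ, α′)`, the scale transfers, and the located smallness `κα₁·c₁(ρ, α′) < 1`: (i) `Δ_{a,□}(U′)` IS A UNIT; (ii) both resolvent identities of (3.86);
(iii) every left entry of `G_□(1)` at rate `ρ` transfers to `G_□(U′)`: `X·G_□(U′) ≺ B₀′c₁(1 − κα₁c₁)⁻¹P(y)e^{−(1−α′)ρd}`.
[cite: Balaban1985BackgroundPropagators, Cor. 3.5 p.407, Thm 3.4 p.400, (3.75)–(3.77) pp.405–406, (3.82)–(3.86) p.407, Thm 3.3 p.399, (3.42) p.397, p.409 l.1–5; Balaban1984PropagatorsII, Lemma 2.1 p.234, (2.66) p.234] -/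
theorem cor35_G_cube_of_pieces₂ (hb₀ : 0 < b₀) (hparS : ∀ z w, parS (fun _ _ => 1) z w = 1) (Rr : ℝ) (H : Prop) (dB dB' : ℕ)
    (δ₀ δ α β ρ α' Λ B₀ cV cP κ₁ κ₂ α₁ : ℝ)
    (hB₀ : 0 ≤ B₀) (hcV : 0 ≤ cV) (hcP : 0 ≤ cP) (hκ₁ : 0 ≤ κ₁) (hκ₂ : 0 ≤ κ₂) (hα₁ : 0 ≤ α₁) (hΛ : 0 ≤ Λ) (hρ : 0 ≤ ρ)
    (hα : 0 ≤ α) (hβ : 0 ≤ β) (hδ₀ : 0 ≤ δ₀) (hr : ρ + (α + β) * δ₀ ≤ δ) (hα' : α' ≤ 1) (hα'ρ : 0 ≤ (1 - α') * ρ)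
    (h261 : Ineq261 dB (toB6 (geoCK i q) Rr H) δ₀ β) (h261' : Ineq261 dB' (toB6 (geoCK i q) Rr H) ρ α')
    (hT1 : ScaleTransfer (geoCK i q) δ₀ α Λ (fun a => (geoCK i q).len a)) (hT2 : ScaleTransfer (geoCK i q) δ₀ α Λ (fun a => (geoCK i q).len a ^ 2))
    (hsmall : kappa385d B₀ (cV + cP) κ₁ κ₂ Λ (B6.c1 dB δ₀ β) (d + 1) * α₁ * B6.c1 dB' ρ α' < 1)
    (V : CfgY 𝔸 i)
    (hG : HasMajorant (g := toB6 (geoCK i q) Rr H) (blkBK i q) (GK b i q parS (parBY i))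
      (fun a a' => B₀ * (geoCK i q).len a ^ 2 * Real.exp (-(δ * (geoCK i q).dist a a'))))
    (hDG : ∀ ν, HasMajorant (g := toB6 (geoCK i q) Rr H) (blkBK i q) (DK b i ν * GK b i q parS (parBY i))
      (fun a a' => B₀ * (geoCK i q).len a * Real.exp (-(δ * (geoCK i q).dist a a'))))
    {V0 P0 PP : Module.End ℝ (FBondY i × ιb → ℝ)} {V1 P1 : Fin (d + 1) → Module.End ℝ (FBondY i × ιb → ℝ)}
    (hLap : lapPieceK b i V = V0 + ∑ ν, V1 ν * DK b i ν)
    (hV0 : HasMajorant (g := toB6 (geoCK i q) Rr H) (blkBK i q) V0 (fun a a' => cV * α₁ * ((geoCK i q).len a ^ 2)⁻¹ * Real.exp (-(δ * (geoCK i q).dist a a'))))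
    (hV1 : ∀ ν, HasMajorant (g := toB6 (geoCK i q) Rr H) (blkBK i q) (V1 ν) (fun a a' => cV * α₁ * ((geoCK i q).len a)⁻¹ * Real.exp (-(δ * (geoCK i q).dist a a'))))
    (hProj : projPieceK b i q parS V = P0 + ∑ ν, P1 ν * DK b i ν + PP)
    (hP0 : HasMajorant (g := toB6 (geoCK i q) Rr H) (blkBK i q) P0 (fun a a' => cP * α₁ * ((geoCK i q).len a ^ 2)⁻¹ * Real.exp (-(δ * (geoCK i q).dist a a'))))
    (hP1 : ∀ ν, HasMajorant (g := toB6 (geoCK i q) Rr H) (blkBK i q) (P1 ν) (fun a a' => cP * α₁ * ((geoCK i q).len a)⁻¹ * Real.exp (-(δ * (geoCK i q).dist a a'))))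
    (hPP : HasMajorant (g := toB6 (geoCK i q) Rr H) (blkBK i q) PP (fun a a' => κ₁ * α₁ * ((geoCK i q).len a ^ 2)⁻¹ * Real.exp (-(δ * (geoCK i q).dist a a'))))
    (hAv : HasMajorant (g := toB6 (geoCK i q) Rr H) (blkBK i q) (avgPieceK b i q V)
      (fun a a' => κ₂ * α₁ * ((geoCK i q).len a ^ 2)⁻¹ * Real.exp (-(δ * (geoCK i q).dist a a')))) :
    IsUnit (deltaACubeY i q parS (parBY i) V) ∧
    (GVK b i q parS (parBY i) V = GK b i q parS (parBY i) + GK b i q parS (parBY i) * VK b i q parS (parBY i) V * GVK b i q parS (parBY i) V ∧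
      GVK b i q parS (parBY i) V = GK b i q parS (parBY i) + GVK b i q parS (parBY i) V * (VK b i q parS (parBY i) V * GK b i q parS (parBY i))) ∧
    ∀ (X : Module.End ℝ (FBondY i × ιb → ℝ)) (B₀' : ℝ) (P : BlkCubeY i q → ℝ), 0 ≤ B₀' → (∀ y, 0 ≤ P y) →
      HasMajorant (g := toB6 (geoCK i q) Rr H) (blkBK i q) (X * GK b i q parS (parBY i))
        (fun a a' => B₀' * P a * Real.exp (-(ρ * (geoCK i q).dist a a'))) →
      HasMajorant (g := toB6 (geoCK i q) Rr H) (blkBK i q) (X * GVK b i q parS (parBY i) V)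
        (fun a a' => B₀' * B6.c1 dB' ρ α' * (1 - kappa385d B₀ (cV + cP) κ₁ κ₂ Λ (B6.c1 dB δ₀ β) (d + 1) * α₁ * B6.c1 dB' ρ α')⁻¹ * P a *
          Real.exp (-((1 - α') * ρ * (geoCK i q).dist a a'))) := by
  have h385 := h385_of_pieces₂ b i q parS Rr H dB δ₀ δ α β ρ Λ B₀ cV cP κ₁ κ₂ α₁ hB₀ hcV hcP hκ₁ hκ₂ hα₁ hΛ hρ hα hβ hδ₀ hr h261 hT1 hT2 V hG hDG hLap
    hV0 hV1 hProj hP0 hP1 hPP hAv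
  have hθ : 0 ≤ kappa385d B₀ (cV + cP) κ₁ κ₂ Λ (B6.c1 dB δ₀ β) (d + 1) * α₁ :=
    mul_nonneg (kappa385d_nonneg hB₀ (add_nonneg hcV hcP) hκ₁ hκ₂ hΛ (B6RandomWalk.c1_nonneg _ _ _)) hα₁
  exact gStep_cube b i q parS (parBY i) hb₀ hparS (Node00.parBY_one i) Rr H dB' hθ hρ hα' hα'ρ h261' hsmall V h385

end Literature.MathematicalPhysics.QuantumFieldTheory.Balaban1983to89.B9Cor35GAtCubeLettersFirstOrder

end
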